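import Summits.CriticalPhenomena.Ising3DConformalLimit.Theorems.HyperoctahedralRPExistsScaleCovariantLimitFunnelDoublingIffAxisRate
import HarnessLib

/-!
# Descending iteration for log-convex positive sequences

Helper for the √n-doubling partial of item 6150, line `folded-current-repulsion` of crux `ExistsScaleCovariantLimit`
(stmt-CriticalPhenomena-1981): for a positive sequence `G` with nondecreasing shifted ratios `k ↦ G(k+2)/G(k+1)`,
moving up `s` steps from an index `k ≥ 1` while staying at indices `≤ n` multiplies `G` by at most `(G(n+1)/G(n))^s`.
-/

namespace Summit.CriticalPhenomena.Ising3DConformalLimit.Cruxes.ExistsScaleCovariantLimit.FoldedCurrentRepulsion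

/-- Descending iteration for a positive sequence with nondecreasing shifted ratios: for `1 ≤ k` and `k + s ≤ n`,
`G(k+s) ≤ (G(n+1)/G(n))^s G(k)` — each one-step ratio `G(m+1)/G(m)`, `k ≤ m ≤ n - 1`, is the monotone family's value
at `m - 1 ≤ n - 1`, hence at most `G(n+1)/G(n)` (the hypothesis `1 ≤ k` excludes the ratio `G 1 / G 0`). [folklore] -/
theorem logConvex_descend : ∀ G : ℕ → ℝ, (∀ n, 0 < G n) → Monotone (fun k => G (k + 2) / G (k + 1)) → ∀ n k s : ℕ, 1 ≤ k → k + s ≤ n → G (k + s) ≤ (G (n + 1) / G n) ^ s * G k := by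
  intro G hpos hmono n k s hk
  induction s with
  | zero => intro _; simp
  | succ s ih =>
    intro hs
    have hs' : k + s ≤ n := by omega
    have hrec : G (k + (s + 1)) = G (k + s - 1 + 2) / G (k + s - 1 + 1) * G (k + s) := by
      rw [show k + (s + 1) = (k + s - 1) + 2 by omega, show k + s - 1 + 1 = k + s by omega]
      exact (div_mul_cancel₀ _ (hpos (k + s)).ne').symm
    have hRle : G (k + s - 1 + 2) / G (k + s - 1 + 1) ≤ G (n + 1) / G n := by
      have h : G (k + s - 1 + 2) / G (k + s - 1 + 1) ≤ G (n - 1 + 2) / G (n - 1 + 1) := hmono (by omega)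
      rwa [show n - 1 + 2 = n + 1 by omega, show n - 1 + 1 = n by omega] at h
    have hRpos : 0 < G (k + s - 1 + 2) / G (k + s - 1 + 1) := div_pos (hpos _) (hpos _)
    rw [hrec, pow_succ]
    calc G (k + s - 1 + 2) / G (k + s - 1 + 1) * G (k + s)
        ≤ G (n + 1) / G n * ((G (n + 1) / G n) ^ s * G k) :=
          mul_le_mul hRle (ih hs') (hpos _).le (hRpos.le.trans hRle)
      _ = (G (n + 1) / G n) ^ s * (G (n + 1) / G n) * G k := by ring

end Summit.CriticalPhenomena.Ising3DConformalLimit.Cruxes.ExistsScaleCovariantLimit.FoldedCurrentRepulsion
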